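import Mathlib
import Summits.QuantumFields.BalabanUV.Beta.UnitLatticeOmegaRowData
import Summits.QuantumFields.BalabanUV.Beta.UnitLatticeOmegaWitness

/-!
# `Summit.QuantumFields.BalabanUV.Beta.UnitLatticeOmegaCells` — A3-loc-ω, THE PRINTED CURRENCY FOR THE PIECE DOMAINS:
# the cells met by a kernel piece's domain `D_ω` are charged DIRECTLY by a per-piece CELL BUDGET `cellsOf ω`
# ([II] p. 5 (1.11): «e^{mκ₁}, m is the number of the parameters s connected with the walk ω») instead of through a
# THREAD (`UnitLatticeOmegaTube`): same tube-count shape `#decΩ ≤ P·(1 + (pathLen + Σ_t cr(ω_t))/r)` with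
# `cr(ω) = (r/P)·#cellsOf ω`, hence the SAME hand-off `RowData` with the per-piece weight `e^{(κ₁P/r)·cr(ω)} = e^{κ₁·#cellsOf ω}`
# — print's cost `e^{κ₁}` PER DECORATION CUBE, no thread, no covering radius `D_f`, no symmetry of `d`

HONEST FRAMING (page 1 of everything in this cell).  Discharging `FlowStep.BetaPertH` would make Bałaban's ultraviolet
stability UNCONDITIONAL — a constructive-QFT result; NOT the continuum limit, NOT the Clay problem.  This module
discharges nothing of `BetaPertH`; [folklore] bookkeeping, kernel-checked (unit `b2b-balaban-beta-d4-p3`, road P3, gen 5;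
skeleton v1.12 §7.9).  WHY (records): the gen-4 hand-off `UnitLatticeOmegaRowData.rowData_decFamilyΩ` reaches the cells
of `D_ω` by a THREAD `thr ω` (a point list covering `D_ω` within `D_f`, credit `cr ω ≥ 3·listLen(thr ω) + 2·D_f`); for the
INSTANCE (pieces regrouped by their decoration cell set `S`, the row owner's `AnalyticWalkSum216RowRegroup.pieceOf`)
a thread through all cells of `S` of length linear in `#S` needs `S` connected and a depth-first traversal, and costs
`e^{(κ₁P/r)·3·(thread length)}` ≈ `e^{c·P·κ₁}` PER CELL with `P` the packing number — against print's `e^{κ₁}` per cell.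
Charging the cells of `D_ω` directly (they are, by construction of the instance, among the cells of `S(ω)`) removes the
thread, the connectivity question and the factor `c·P` at once.  The gen-4 thread theorems stay correct; the row owner's
THEOREM-B files (`AnalyticWalkSum216RowResolventOmega` p217377, `…RowConstrained` p218683, `…RowResolventProj` p218312)
consume the thread version BY NAME and obtain the cell version by the three-binder substitution
`(thr, hthr, hcr) ↦ (cellsOf, hcells, hcr)` displayed in §3 (their other inputs — `resummation_identity₂`, `wrs_Rem₂_le`,
`termSum_decFamilyΩ_one`, `inv_one_add_eq'` — are thread-free).
HONEST DEPENDENCY: continuum YM on T⁴ ⇐ BetaPertH ∧ nine spine estimates (0/9 proved); BetaPertH ⇐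
(D1) ∧ (D4) ∧ CAP+tail; G-an2-4 gates asym, D1 and NE2/3/4.

CITATION (locator only; nothing printed is used as a hypothesis).  [II] = T. Bałaban, *Renormalization group approach to
lattice gauge field theories. II. Cluster expansions*, Commun. Math. Phys. **116**, 1–22 (1988) [Balaban1988RG2Cluster],
p. 3 («for a random walk ω localized in X̃₀⁵ ∪ ⋯ ∪ X̃_n⁵ we take the {Δ₁, …, Δ_m} of all cubes from σ₀ which intersect this
localization domain, and we multiply the term … by s(Δ₁)⋯s(Δ_m)») and p. 5 (1.11) («e^{mκ₁}»), both quoted in full in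
`Literature.….B13WalkCubes111`'s header (renders read there).

CONTENTS (0 sorry).  §1 `cellsΩ` (the union of the cell budgets along a term), `card_cellsΩ_le`.  §2 `exists_anchorsΩ_cells`
(anchors along the MAIN chain only; every decoration cell is within `R` of an anchor OR in `cellsΩ`), **`card_decΩ_le_cells`**
(`#decΩ ≤ P·(1 + (pathLen(y) + crSum cr)/r)` from `hcells : cellOf z ∈ cellsOf ω` for `z ∈ D_ω` and
`hcr : r·#cellsOf ω ≤ P·cr ω`).  §3 **`rowData_decFamilyΩ_cells`** — the hand-off with `(cellsOf, hcells, hcr)` in place of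
`(thr, hthr, hcr)` and WITHOUT `hsymm`, `D_f`, `hRf`; `crCells` (the canonical credit `(r/P)·#cellsOf ω`), `crCells_spec`,
`exp_rate_crCells` (the weight is `e^{κ₁·#cellsOf ω}`), `crCells_nonneg`.  §4 non-vacuity (`rowData_cells_witness`, by
APPLYING §3 to the one-site data of `UnitLatticeOmegaWitness`).  `termSum_decFamilyΩ_one` applies verbatim (thread-free).
NOT HERE: budgets `K₁″`, `Φ` from a piece bound (`UnitLatticeOmegaBudgets`, next), any instance on Bałaban's operators
((T3), NODE O.2 untouched).  NOT summit progress.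
-/

open scoped BigOperators Matrix
open Finset Matrix Metric

namespace Summit.QuantumFields.BalabanUV.Beta.UnitLatticeOmegaCells

open Summit.QuantumFields.BalabanUV.Beta.UnitLatticeWalkInversion
open Summit.QuantumFields.BalabanUV.Beta.UnitLatticeTubeCount (pathLen pathLen_succ pathLen_nonneg)
open Summit.QuantumFields.BalabanUV.Beta.UnitLatticeOmegaTerms
open Summit.QuantumFields.BalabanUV.Beta.UnitLatticeOmegaTube (crSum crSum_nonneg decΩ listLen lastOf anchors_extend
  lastOf_append_singleton listLen_cons_cons)
open Summit.QuantumFields.BalabanUV.Beta.UnitLatticeOmegaPaths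
open Summit.QuantumFields.BalabanUV.Beta.UnitLatticeOmegaRowData
open Summit.QuantumFields.BalabanUV.Beta.AnalyticWalkSum216RowData (RowData)
open Literature.MathematicalPhysics.QuantumFieldTheory.Balaban1983to89.B13PerturbativeStep (wrs WRS WeightHyp)

noncomputable section

variable {Y : Type*} {B Ω : Type*} {Δ : Type*} [DecidableEq Δ]

/-! ## §1 The union of the cell budgets along a term -/

/-- `cellsΩ cellsOf n c⃗ := ⋃_t cellsOf (ω_t)` — the cells CHARGED to the kernel pieces of the term (recursion as `crSum`).
[folklore] -/
def cellsΩ (cellsOf : Ω → Finset Δ) : (n : ℕ) → (Fin n → B × Ω) → Finset Δ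
  | 0, _ => ∅
  | n + 1, c => cellsΩ cellsOf n (Fin.init c) ∪ cellsOf (c (Fin.last n)).2

/-- **`r·#cellsΩ ≤ P·crSum`** (`r ≥ 0`) when every piece's credit pays for its cells: `r·#cellsOf ω ≤ P·cr ω`. [folklore] -/
theorem card_cellsΩ_le (cellsOf : Ω → Finset Δ) (cr : Ω → ℝ) {r P : ℝ} (hr : 0 ≤ r)
    (hcr : ∀ ω, r * ((cellsOf ω).card : ℝ) ≤ P * cr ω) :
    ∀ (n : ℕ) (c : Fin n → B × Ω), r * ((cellsΩ cellsOf n c).card : ℝ) ≤ P * crSum cr n c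
  | 0, _ => by simp [cellsΩ, crSum]
  | n + 1, c => by
      rw [cellsΩ, crSum, mul_add]
      have h1 := card_cellsΩ_le cellsOf cr hr hcr n (Fin.init c)
      have h2 := hcr (c (Fin.last n)).2
      have hu : (((cellsΩ cellsOf n (Fin.init c) ∪ cellsOf (c (Fin.last n)).2).card : ℕ) : ℝ)
          ≤ (cellsΩ cellsOf n (Fin.init c)).card + (cellsOf (c (Fin.last n)).2).card := by
        exact_mod_cast Finset.card_union_le _ _
      calc r * (((cellsΩ cellsOf n (Fin.init c) ∪ cellsOf (c (Fin.last n)).2).card : ℕ) : ℝ)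
          ≤ r * ((cellsΩ cellsOf n (Fin.init c)).card + (cellsOf (c (Fin.last n)).2).card) :=
            mul_le_mul_of_nonneg_left hu hr
        _ = r * (cellsΩ cellsOf n (Fin.init c)).card + r * (cellsOf (c (Fin.last n)).2).card := by ring
        _ ≤ P * crSum cr n (Fin.init c) + P * cr (c (Fin.last n)).2 := add_le_add h1 h2

/-- `cellsOf (ω_t) ⊆ cellsΩ` for the last step. [folklore] -/
theorem cellsOf_last_subset (cellsOf : Ω → Finset Δ) (n : ℕ) (c : Fin (n + 1) → B × Ω) :
    cellsOf (c (Fin.last n)).2 ⊆ cellsΩ cellsOf (n + 1) c := by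
  rw [cellsΩ]
  exact Finset.subset_union_right

/-- `cellsΩ n (init c⃗) ⊆ cellsΩ (n+1) c⃗`. [folklore] -/
theorem cellsΩ_init_subset (cellsOf : Ω → Finset Δ) (n : ℕ) (c : Fin (n + 1) → B × Ω) :
    cellsΩ cellsOf n (Fin.init c) ⊆ cellsΩ cellsOf (n + 1) c := by
  rw [cellsΩ]
  exact Finset.subset_union_left

/-! ## §2 Anchors along the main chain only; the count -/

/-- **ANCHORS FOR THE FULL DECORATION, CELL CURRENCY.**  Pseudo-metric `d` (triangle inequality, `d(a,a) = 0`, `d ≥ 0`; NO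
symmetry); cube neighbourhoods `E b` of diameter `≤ D`; every site of a piece domain `D_ω` lies in a cell of the piece's
budget `cellsOf ω`; `0 ≤ r`, `r + D ≤ R`.  For every ADMISSIBLE chain `y` of a term there are anchor points `A` (last anchor
`a`) along the MAIN chain such that every decoration cell either has a point within `R` of an anchor or is a charged cell
(`∈ cellsΩ`), and `(#A − 1)·r + d(a, y_n) ≤ pathLen(y)`. [folklore] -/
theorem exists_anchorsΩ_cells [DecidableEq Y] (d : Y → Y → ℝ) (htri : ∀ a b c, d a c ≤ d a b + d b c)
    (hzero : ∀ a, d a a = 0) (hnn : ∀ a b, 0 ≤ d a b) {r D R : ℝ} (hr : 0 ≤ r) (hRD : r + D ≤ R)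
    (cellOf : Y → Δ) (E : B → Finset Y) (hdiam : ∀ b, ∀ z ∈ E b, ∀ z' ∈ E b, d z z' ≤ D) (Dω : Ω → Finset Y)
    (cellsOf : Ω → Finset Δ) (hcells : ∀ ω, ∀ z ∈ Dω ω, cellOf z ∈ cellsOf ω) :
    ∀ (n : ℕ) (b₀ : B) (c : Fin n → B × Ω) (y : Fin (n + 1) → Y), AdmΩ E Dω n b₀ c y →
      ∃ (A : Finset Y) (a : Y), a ∈ A ∧
        (∀ δ ∈ decΩ cellOf E Dω n b₀ c, (∃ s ∈ A, ∃ z, cellOf z = δ ∧ d s z ≤ R) ∨ δ ∈ cellsΩ cellsOf n c) ∧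
        ((A.card : ℝ) - 1) * r + d a (y (Fin.last n)) ≤ pathLen d n y
  | 0, b₀, c, y, hy => by
      refine ⟨{y 0}, y 0, Finset.mem_singleton_self _, fun δ hδ => ?_, ?_⟩
      · obtain ⟨z, hz, rfl⟩ := Finset.mem_image.1 hδ
        exact Or.inl ⟨y 0, Finset.mem_singleton_self _, z, rfl, (hdiam b₀ (y 0) hy z hz).trans (by linarith)⟩
      · have h0 : Fin.last 0 = 0 := rfl
        rw [Finset.card_singleton, h0, hzero]
        simp [pathLen]
  | n + 1, b₀, c, y, hy => by
      obtain ⟨hy0, _, hyE⟩ := hy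
      obtain ⟨A₀, a₀, ha₀, hcov₀, hinv₀⟩ :=
        exists_anchorsΩ_cells d htri hzero hnn hr hRD cellOf E hdiam Dω cellsOf hcells n b₀ (Fin.init c) (Fin.init y) hy0
      set ω := (c (Fin.last n)).2 with hω
      set b' := (c (Fin.last n)).1 with hb'
      set u := y (Fin.last n).castSucc with hu
      set v := y (Fin.last (n + 1)) with hv
      have hinit : (Fin.init y) (Fin.last n) = u := rfl
      rw [hinit] at hinv₀
      -- attach the new end point `v` directly (no side trip)
      obtain ⟨A', a', hsub, ha', hcov, hinv'⟩ :=
        anchors_extend d htri hzero hr [v] u A₀ a₀ (pathLen d n (Fin.init y)) ha₀ hinv₀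
      have hlen : listLen d (u :: [v]) = d u v := by
        rw [listLen_cons_cons]
        simp [listLen]
      refine ⟨A', a', ha', fun δ hδ => ?_, ?_⟩
      · rcases Finset.mem_union.1 hδ with hδ | hδ
        · rcases Finset.mem_union.1 hδ with hδ | hδ
          · rcases hcov₀ δ hδ with ⟨s, hs, z, hz, hsz⟩ | hmem
            · exact Or.inl ⟨s, hsub hs, z, hz, hsz⟩
            · exact Or.inr (cellsΩ_init_subset cellsOf n c hmem)
          · obtain ⟨z, hz, rfl⟩ := Finset.mem_image.1 hδ
            exact Or.inr (cellsOf_last_subset cellsOf n c (hcells ω z hz))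
        · obtain ⟨z, hz, rfl⟩ := Finset.mem_image.1 hδ
          obtain ⟨s, hs, hsv⟩ := hcov v (List.mem_singleton_self v)
          exact Or.inl ⟨s, hs, z, rfl, by linarith [htri s v z, hdiam b' v hyE z hz]⟩
      · have hl : lastOf u [v] = v := lastOf_append_singleton u [] v
        rw [hl, hlen] at hinv'
        rw [pathLen_succ]
        exact hinv'

/-- **THE TUBE COUNT, CELL CURRENCY**: with PACKING (`≤ P` cells per `R`-ball), `0 < r`, and per-piece credits paying for the
charged cells (`r·#cellsOf ω ≤ P·cr ω`), for every admissible chain `y`: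
`#decΩ ≤ P·(1 + (pathLen(y) + crSum cr)/r)` — the SAME shape as `UnitLatticeOmegaTube.card_decΩ_le`, so every downstream
majorant∕`RowData` statement keeps its letters; with `cr ω = (r/P)·#cellsOf ω` the per-piece weight downstream is
`e^{κ₁·#cellsOf ω}` ([II] (1.11)'s `e^{mκ₁}`). [folklore] -/
theorem card_decΩ_le_cells [DecidableEq Y] (d : Y → Y → ℝ) (htri : ∀ a b c, d a c ≤ d a b + d b c)
    (hzero : ∀ a, d a a = 0) (hnn : ∀ a b, 0 ≤ d a b) {r D R : ℝ} (hr : 0 < r) (hRD : r + D ≤ R) (cellOf : Y → Δ)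
    {P : ℕ} (hpack : ∀ a : Y, ∃ S : Finset Δ, S.card ≤ P ∧ ∀ z, d a z ≤ R → cellOf z ∈ S) (E : B → Finset Y)
    (hdiam : ∀ b, ∀ z ∈ E b, ∀ z' ∈ E b, d z z' ≤ D) (Dω : Ω → Finset Y) (cellsOf : Ω → Finset Δ)
    (hcells : ∀ ω, ∀ z ∈ Dω ω, cellOf z ∈ cellsOf ω) (cr : Ω → ℝ)
    (hcr : ∀ ω, r * ((cellsOf ω).card : ℝ) ≤ P * cr ω) {n : ℕ} (b₀ : B) (c : Fin n → B × Ω)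
    (y : Fin (n + 1) → Y) (hy : AdmΩ E Dω n b₀ c y) :
    ((decΩ cellOf E Dω n b₀ c).card : ℝ) ≤ P * (1 + (pathLen d n y + crSum cr n c) / r) := by
  obtain ⟨A, a, _, hcov, hinv⟩ :=
    exists_anchorsΩ_cells d htri hzero hnn hr.le hRD cellOf E hdiam Dω cellsOf hcells n b₀ c y hy
  choose S hS using hpack
  have hsub : decΩ cellOf E Dω n b₀ c ⊆ (A.biUnion fun s => S s) ∪ cellsΩ cellsOf n c := by
    intro δ hδ
    rcases hcov δ hδ with ⟨s, hs, z, hz, hsz⟩ | hmem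
    · exact Finset.mem_union_left _ (Finset.mem_biUnion.2 ⟨s, hs, hz ▸ (hS s).2 z hsz⟩)
    · exact Finset.mem_union_right _ hmem
  have hcardA : (A.card : ℝ) ≤ 1 + pathLen d n y / r := by
    have h1 : ((A.card : ℝ) - 1) * r ≤ pathLen d n y := by linarith [hnn a (y (Fin.last n))]
    have h2 : (A.card : ℝ) - 1 ≤ pathLen d n y / r := by rwa [le_div_iff₀ hr]
    linarith
  have hcells' : ((cellsΩ cellsOf n c).card : ℝ) ≤ P * (crSum cr n c / r) := by
    have h1 := card_cellsΩ_le cellsOf cr hr.le hcr n c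
    rw [mul_div_assoc', le_div_iff₀ hr, mul_comm]
    exact h1
  calc ((decΩ cellOf E Dω n b₀ c).card : ℝ)
      ≤ (((A.biUnion fun s => S s) ∪ cellsΩ cellsOf n c).card : ℝ) := by exact_mod_cast Finset.card_le_card hsub
    _ ≤ ((A.biUnion fun s => S s).card : ℝ) + ((cellsΩ cellsOf n c).card : ℝ) := by
        exact_mod_cast Finset.card_union_le _ _
    _ ≤ ((∑ s ∈ A, (S s).card : ℕ) : ℝ) + ((cellsΩ cellsOf n c).card : ℝ) := by
        gcongr
        exact_mod_cast Finset.card_biUnion_le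
    _ ≤ (A.card : ℝ) * P + P * (crSum cr n c / r) := by
        refine add_le_add ?_ hcells'
        push_cast
        calc ∑ s ∈ A, ((S s).card : ℝ) ≤ ∑ _s ∈ A, (P : ℝ) := Finset.sum_le_sum fun s _ => by exact_mod_cast (hS s).1
          _ = A.card * P := by rw [Finset.sum_const, nsmul_eq_mul]
    _ ≤ (1 + pathLen d n y / r) * P + P * (crSum cr n c / r) := by
        gcongr
    _ = P * (1 + (pathLen d n y + crSum cr n c) / r) := by ring

/-! ## §3 The hand-off in the cell currency -/

section Wrs

variable [Fintype Y] [DecidableEq Y] [DecidableEq Ω] {κ : ℝ} {d : Y → Y → ℝ}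

/-- **THE HAND-OFF FOR THE FULL DECORATION, CELL CURRENCY.**  As `UnitLatticeOmegaRowData.rowData_decFamilyΩ` with the thread
data `(thr, hthr, hcr)` REPLACED by a per-piece cell budget: `cellsOf : Ω → Finset Δ`, `hcells : z ∈ D_ω → cellOf z ∈ cellsOf ω`,
`hcr : r·#cellsOf ω ≤ P·cr ω`; NO symmetry of `d`, NO covering radius `D_f` (only `r + D ≤ R`).  Pseudo-metric `d`
(`WeightHyp κ d`); partition data (supports `E b` of diameter `≤ D`, `|h| ≤ 1`, Lipschitz `1/M`, overlap `N`); pieces `K_ω`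
block-local on `D_ω`; cells with packing `P` at radius `R`, `0 < r`; budgets AT RATE `κ + κ₁P/r` with the credits folded in
(`C_L′`, `K₁″`, `Φ`); smallness `ρ_Ω = C_L′·((2N/M)·K₁″ + Φ) < 1`; frozen values `‖τ(Δ)‖ ≤ e^{κ₁}`, `κ₁ ≥ 0`.  THEN the fully
decorated ω-family with the coordinate `Δ₀` free is ROW DATA on `‖σ‖ < e^{κ₁}` at rate `κ` with majorant
`e^{κ₁P}·walkMajΩ (κ₁P/r)` and constant `e^{κ₁P}·N·C_L′·(1 − ρ_Ω)⁻¹` — volume-free, `Δ₀`- and `τ`-free.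
[cite: Balaban1988RG2Cluster, (1.11) p.5] -/
theorem rowData_decFamilyΩ_cells [Fintype B] [Fintype Ω] (hw : WeightHyp κ d)
    (K : Ω → Matrix Y Y ℂ) (Dω : Ω → Finset Y) (hK : ∀ ω k l, K ω k l ≠ 0 → k ∈ Dω ω) (near : B → Finset Ω)
    (h : B → Y → ℝ) (E : B → Finset Y) (L : B → Matrix Y Y ℂ) (hsupp : ∀ b y, y ∉ E b → h b y = 0)
    (habs : ∀ b y, |h b y| ≤ 1) {M N C_L K₁ Φ κ₁ r D R : ℝ} (hM : 0 < M)
    (hLip : ∀ b y y', |h b y - h b y'| ≤ d y y' / M) (hN : ∀ y, ((Finset.univ.filter fun b => y ∈ E b).card : ℝ) ≤ N)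
    (hC : 0 ≤ C_L) (hκ₁ : 0 ≤ κ₁) (hr : 0 < r) (hRD : r + D ≤ R) (cellOf : Y → Δ) {P : ℕ}
    (hpack : ∀ a : Y, ∃ S : Finset Δ, S.card ≤ P ∧ ∀ z, d a z ≤ R → cellOf z ∈ S)
    (hdiam : ∀ b, ∀ z ∈ E b, ∀ z' ∈ E b, d z z' ≤ D) (cellsOf : Ω → Finset Δ)
    (hcells : ∀ ω, ∀ z ∈ Dω ω, cellOf z ∈ cellsOf ω) (cr : Ω → ℝ)
    (hcr : ∀ ω, r * ((cellsOf ω).card : ℝ) ≤ P * cr ω)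
    (hL : ∀ b, WRS (κ + κ₁ * (P / r)) d (L b) C_L)
    (hK₁ : ∀ k, ∑ ω, ∑ l, ‖K ω k l‖ * d k l * Real.exp ((κ + κ₁ * (P / r)) * d k l + κ₁ * (P / r) * cr ω) ≤ K₁)
    (hΦ : ∀ k, ∑ ω, ∑ l, (∑ b, if ω ∈ near b then (0 : ℝ) else |h b l|) * ‖K ω k l‖
      * Real.exp ((κ + κ₁ * (P / r)) * d k l + κ₁ * (P / r) * cr ω) ≤ Φ)
    (hρ : C_L * (2 * N / M * K₁ + Φ) < 1) (τ : Δ → ℂ) (hτ : ∀ δ, ‖τ δ‖ ≤ Real.exp κ₁) (Δ₀ : Δ) :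
    RowData κ d (Real.exp κ₁) (decFamilyΩ cellOf E Dω h K near L τ Δ₀)
      (decMajΩ (Real.exp (κ₁ * P)) (κ₁ * (P / r)) d cr h K near L)
      (Real.exp (κ₁ * P) * (N * C_L) * (1 - C_L * (2 * N / M * K₁ + Φ))⁻¹) where
  ha w i j := by
    simp only [decFamilyΩ, Matrix.smul_apply, smul_eq_mul]
    exact (differentiableOn_monoAt τ Δ₀ _ _).mul (differentiableOn_const _)
  hm w σ hσ i j := by
    rw [decFamilyΩ, Matrix.smul_apply, smul_eq_mul, norm_mul, decMajΩ]
    have hδ : 0 ≤ κ₁ * (P / r) := mul_nonneg hκ₁ (div_nonneg (Nat.cast_nonneg P) hr.le)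
    refine norm_coeff_mul_walkTermΩ_le h E hsupp K Dω hK near L hδ d hw.nonneg hw.tri cr (Real.exp_pos _).le
      w.1 w.2.1 w.2.2 _ (fun y hy => ?_) i j
    have hσ' : ‖σ‖ ≤ Real.exp κ₁ := (mem_ball_zero_iff.1 hσ).le
    refine (norm_monoAt_le hτ Δ₀ _ hσ').trans ?_
    rw [← Real.exp_nat_mul, ← Real.exp_add]
    refine Real.exp_le_exp.2 ?_
    have hcnt := card_decΩ_le_cells d hw.tri hw.zero hw.nonneg hr hRD cellOf hpack E hdiam Dω cellsOf hcells cr hcr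
      w.2.1 w.2.2 y hy
    have := mul_le_mul_of_nonneg_left hcnt hκ₁
    calc ((decΩ cellOf E Dω w.1 w.2.1 w.2.2).card : ℝ) * κ₁ = κ₁ * (decΩ cellOf E Dω w.1 w.2.1 w.2.2).card :=
          mul_comm _ _
      _ ≤ κ₁ * (P * (1 + (pathLen d w.1 y + crSum cr w.1 w.2.2) / r)) := this
      _ = κ₁ * P + κ₁ * (P / r) * (pathLen d w.1 y + crSum cr w.1 w.2.2) := by ring
  hsum i j := summable_decMajΩ hw (Real.exp_pos _).le cr K near h E L hsupp habs hM hLip hN hC hL hK₁ hΦ hρ i j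
  hρ i := row_majSum_decMajΩ_le hw (Real.exp_pos _).le cr K near h E L hsupp habs hM hLip hN hC hL hK₁ hΦ hρ i

/-- THE CANONICAL CREDIT in the cell currency: `crCells r P cellsOf ω := (r/P)·#cellsOf ω`. [folklore] -/
def crCells (r : ℝ) (P : ℕ) (cellsOf : Ω → Finset Δ) (ω : Ω) : ℝ := r / P * (cellsOf ω).card

omit [DecidableEq Δ] [DecidableEq Ω] in
/-- `crCells` pays for the cells: `r·#cellsOf ω ≤ P·crCells ω` (equality for `P > 0`). [folklore] -/
theorem crCells_spec {r : ℝ} {P : ℕ} (hP : 0 < P) (cellsOf : Ω → Finset Δ) (ω : Ω) :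
    r * ((cellsOf ω).card : ℝ) ≤ P * crCells r P cellsOf ω := by
  have hP' : (P : ℝ) ≠ 0 := Nat.cast_ne_zero.2 hP.ne'
  rw [crCells, ← mul_assoc, mul_div_cancel₀ _ hP']

omit [DecidableEq Δ] [DecidableEq Ω] in
/-- `crCells ≥ 0` for `r ≥ 0`. [folklore] -/
theorem crCells_nonneg {r : ℝ} (hr : 0 ≤ r) (P : ℕ) (cellsOf : Ω → Finset Δ) (ω : Ω) : 0 ≤ crCells r P cellsOf ω :=
  mul_nonneg (div_nonneg hr (Nat.cast_nonneg P)) (Nat.cast_nonneg _)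

omit [DecidableEq Δ] [DecidableEq Ω] in
/-- **THE WEIGHT IS PRINT'S `e^{mκ₁}`**: `(κ₁P/r)·crCells ω = κ₁·#cellsOf ω` (`P > 0`, `r ≠ 0`), so the per-piece factor
`e^{(κ₁P/r)·cr ω}` in `K₁″`, `Φ` is `e^{κ₁·#cellsOf ω}`. [cite: Balaban1988RG2Cluster, (1.11) p.5] -/
theorem rate_mul_crCells {κ₁ r : ℝ} (hr : r ≠ 0) {P : ℕ} (hP : 0 < P) (cellsOf : Ω → Finset Δ) (ω : Ω) :
    κ₁ * (P / r) * crCells r P cellsOf ω = κ₁ * (cellsOf ω).card := by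
  have hP' : (P : ℝ) ≠ 0 := Nat.cast_ne_zero.2 hP.ne'
  rw [crCells]
  field_simp

end Wrs

/-! ## §4 Non-vacuity -/

section Witness

open Summit.QuantumFields.BalabanUV.Beta.UnitLatticeOmegaWitness (d0 h1 E1 K0 near0 L1 Dω0 weightHyp_zero wrs_L1)

/-- Empty cell budgets (the toy pieces have empty domains). [folklore] -/
def cells0 : Fin 1 → Finset (Fin 1) := fun _ => ∅

/-- **NON-VACUITY OF THE CELL-CURRENCY HAND-OFF**: the conclusion of `rowData_decFamilyΩ_cells` is inhabited on the one-site
data of `UnitLatticeOmegaWitness` — obtained by APPLYING the theorem, every binder discharged (`κ = 0`, `κ₁ = 1`,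
`M = N = C_L = r = R = 1`, `K₁″ = Φ = D = 0`, `P = 1`, `cellsOf ≡ ∅`, credits `crCells`, `τ ≡ 1`, `Δ₀ = 0`). [folklore] -/
theorem rowData_cells_witness :
    RowData 0 d0 (Real.exp 1) (decFamilyΩ (fun y : Fin 1 => y) E1 Dω0 h1 K0 near0 L1 (fun _ => (1 : ℂ)) 0)
      (decMajΩ (Real.exp (1 * (1 : ℕ))) (1 * ((1 : ℕ) / 1)) d0 (crCells 1 1 cells0) h1 K0 near0 L1)
      (Real.exp (1 * (1 : ℕ)) * (1 * 1) * (1 - 1 * (2 * 1 / 1 * 0 + 0))⁻¹) := by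
  refine rowData_decFamilyΩ_cells (κ := 0) (weightHyp_zero le_rfl) K0 Dω0 (fun ω k l hk => ?_) near0 h1 E1
    L1 (fun b y hy => absurd (Finset.mem_univ y) hy) (fun b y => by simp [h1]) (M := 1) (N := 1) (C_L := 1) (K₁ := 0)
    (Φ := 0) (κ₁ := 1) (r := 1) (D := 0) (R := 1) one_pos (fun b y y' => by simp [h1, d0]) (fun y => ?_)
    zero_le_one zero_le_one one_pos (by norm_num) (fun y : Fin 1 => y) (P := 1) (fun a => ?_)
    (fun b z _ z' _ => le_of_eq rfl) cells0 (fun ω z hz => absurd hz (Finset.notMem_empty z)) (crCells 1 1 cells0)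
    (fun ω => crCells_spec one_pos cells0 ω) (fun b => ?_) (fun k => ?_) (fun k => ?_) (by norm_num) (fun _ => (1 : ℂ))
    (fun δ => by rw [norm_one]; exact (Real.one_lt_exp_iff.2 one_pos).le) 0
  · simp [K0] at hk
  · have hc := Finset.card_filter_le (Finset.univ : Finset (Fin 1)) (fun b => y ∈ E1 b)
    rw [Finset.card_univ, Fintype.card_fin] at hc
    exact_mod_cast hc
  · exact ⟨Finset.univ, by simp, fun z _ => Finset.mem_univ _⟩
  · simpa using wrs_L1 (κ := 0 + 1 * ((1 : ℕ) / 1)) (by norm_num) b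
  · simp [K0]
  · simp [K0]

end Witness

end

end Summit.QuantumFields.BalabanUV.Beta.UnitLatticeOmegaCells
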